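import Mathlib
import HarnessLib
import Summits.Ventures.LatticeQCDFlow.Exactness.SU2MaskedKickErgodic
import Summits.Ventures.LatticeQCDFlow.Exactness.SU2MaskedKickSchedule
import Summits.Ventures.LatticeQCDFlow.Exactness.SU2WilsonFlowLOSubstep
import Summits.Ventures.LatticeQCDFlow.Exactness.SU2ResidualLayer

/-!
# Whole members: a schedule of masked `SU(2)` kick layers has a pinched running log-det; FT-HMC (single-step leapfrog) through the whole member is uniformly ergodic

HONEST FRAMING: exact (Metropolis-corrected) sampling algorithms for lattice gauge theory;
figures of merit are autocorrelation/cost numbers at stated couplings and volumes; no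
continuum-physics claim.

Venture `LatticeQCDFlow` (cell pub-lqcd), topic `Exactness`; FANOUT row 14 (`eng-flowhmc`, engine
`latflow.fthmc`, family B; members = `lax.scan` schedules of masked kick layers with an accumulated
log-det: `maps.wilson_flow_lo`, `maps.residual_trained_scan`).  NEW WORK of the cell; nothing is
cited as a fact; no number.  `SU2MaskedKickErgodic.lean` did ONE layer.  Here the whole member:
`SU2MaskedKickSchedule.exists_layers_su2MaskedKick` packages a schedule as a list of certified
layers, `NCPLayerEquiv.hasJacobian_foldr_trans` composes them (`F = F_n ∘ ⋯ ∘ F_1`, density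
`J(v) = J_1(v) J_2(F_1 v) ⋯`), and

* `foldr_logDet_mem_Icc` — a running product of densities each in `[a, b]` (`0 ≤ a`) lies in
  `[a^n, b^n]`, `n` = number of layers (any space);
* **`su2MaskedKickSchedule_fthmc_uniformlyErgodic`** — for layer specs `s : σ` (mask `P s`, step
  `εf s`, frozen measurable field `Jf s`) under the UNIFORM refusal bound
  `|εf s| ‖Jf s V e‖ ≤ κ₀`, `0 ≤ κ₀ < 1`, and any schedule `sched : List σ`: the member
  (composite measurable equivalence of the packaged layers) with its running density drives row
  9's reported single-step leapfrog FT-HMC kernel to `π_S` geometrically in total variation, from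
  every initial law, for every measurable `|S| ≤ s`, `‖g‖ ≤ b`, `ε', κ' > 0`;
  **`su2MaskedKickSchedule_fthmc_invariant_unique`** — `π_S` is its unique invariant law.
* **`su2WilsonFlowLO_member_fthmc_uniformlyErgodic`** — the instance: the engine's whole LO
  member for ANY schedule `sched : List (Fin d × X)` (layers packaged VERBATIM as in
  `exists_layers_su2WilsonFlowLO`; proper colouring, `2(d−1)|ε| < 1`, `κ₀ = 2(d−1)|ε|`);
  **`su2Residual_member_fthmc_uniformlyErgodic`** — the learned member for ANY schedule of layer
  specs (packaged VERBATIM as in `exists_layers_su2Residual`) under `|cf s| Σ|ρf s| ≤ κ₀ < 1`.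

NOT CLAIMED: multi-step trajectories / OMF words inside row 9's kernel; any usable `δ`; floating
point; `SU(N ≥ 3)`; any number.
-/

noncomputable section

namespace Summit.Ventures.LatticeQCDFlow.Exactness

open Real Set MeasureTheory Measure InnerProductGeometry ProbabilityTheory ProbabilityTheory.Kernel
open Literature.MathematicalPhysics.QuantumFieldTheory
open scoped ENNReal Matrix

/-! ## A running product of pinched densities is pinched -/

section Foldr

variable {Ω : Type*} [MeasurableSpace Ω]

/-- If every layer density takes values in `[a, b]` with `0 ≤ a`, the running density of the
member (the `foldr` of `hasJacobian_foldr_trans`) takes values in `[a^n, b^n]`, `n = #layers`. -/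
theorem foldr_logDet_mem_Icc (layers : List ((Ω ≃ᵐ Ω) × (Ω → ℝ))) {a b : ℝ} (ha : 0 ≤ a)
    (h : ∀ Ly ∈ layers, ∀ v, Ly.2 v ∈ Icc a b) (v : Ω) :
    layers.foldr (fun Ly K => fun v => Ly.2 v * K (Ly.1 v)) (fun _ => (1 : ℝ)) v ∈
      Icc (a ^ layers.length) (b ^ layers.length) := by
  induction layers generalizing v with
  | nil => simp
  | cons Ly rest ih =>
    have hLy := h Ly (List.mem_cons.mpr (Or.inl rfl)) v
    have hrest := ih (fun L hL => h L (List.mem_cons_of_mem _ hL)) (Ly.1 v)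
    simp only [List.foldr_cons, List.length_cons, pow_succ']
    exact ⟨mul_le_mul hLy.1 hrest.1 (pow_nonneg ha _) (ha.trans hLy.1),
      mul_le_mul hLy.2 hrest.2 ((pow_nonneg ha _).trans hrest.1) ((ha.trans hLy.1).trans hLy.2)⟩

end Foldr

/-! ## FT-HMC through a whole schedule is uniformly ergodic -/

section Schedule

variable {d L : ℕ} [NeZero L] {σ : Type*} (P : σ → Edge d L → Prop) [∀ s, DecidablePred (P s)]

/-- **FT-HMC (row 9's single-step leapfrog kernel) through a whole schedule of masked `SU(2)` kick
layers is uniformly ergodic.**  Specs `s : σ` with mask `P s`, step `εf s`, frozen measurable field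
`Jf s`, uniform refusal bound `|εf s| ‖Jf s V e‖ ≤ κ₀` (`0 ≤ κ₀ < 1`); `sched : List σ`.  There
is a list of certified layers (forward maps and densities = the masked kicks and booked factors of
the schedule, position by position) whose composite `F` and running density `J` satisfy: for some
`δ ∈ (0, 1]`, `|μ₀ K̃ᵗ(A) − π_S(A)| ≤ (1 − δ)ᵗ` for the reported kernel `K̃ = F ∘ K_(S∘F − log J) ∘ F⁻¹`,
every initial law `μ₀`, every `t`, every `A`. -/
theorem su2MaskedKickSchedule_fthmc_uniformlyErgodic (εf : σ → ℝ)
    (Jf : σ → GaugeConfig d L (Matrix.specialUnitaryGroup (Fin 2) ℂ) → Edge d L → R4)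
    (hJm : ∀ s e, P s e → Measurable fun V : GaugeConfig d L (Matrix.specialUnitaryGroup (Fin 2) ℂ) => Jf s V e)
    (hJloc : ∀ s (V W : GaugeConfig d L (Matrix.specialUnitaryGroup (Fin 2) ℂ)),
      (∀ j, ¬P s j → V j = W j) → ∀ e, P s e → Jf s V e = Jf s W e)
    {κ₀ : ℝ} (hκ0 : 0 ≤ κ₀) (hκ₀ : κ₀ < 1)
    (hκ : ∀ s (V : GaugeConfig d L (Matrix.specialUnitaryGroup (Fin 2) ℂ)) (e : Edge d L), P s e → |εf s| * ‖Jf s V e‖ ≤ κ₀)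
    (sched : List σ)
    {ε' κ' : ℝ} (hε' : 0 < ε') (hκ' : 0 < κ')
    {g : GaugeConfig d L (Matrix.specialUnitaryGroup (Fin 2) ℂ) → Edge d L → EuclideanSpace ℝ (Fin 3)} (hg : Measurable g) {b' : ℝ} (hb0 : 0 ≤ b')
    (hb : ∀ u l, ‖g u l‖ ≤ b') {S : GaugeConfig d L (Matrix.specialUnitaryGroup (Fin 2) ℂ) → ℝ} (hS : Measurable S) {s' : ℝ} (hs : ∀ u, |S u| ≤ s') :
    ∃ layers : List ((GaugeConfig d L (Matrix.specialUnitaryGroup (Fin 2) ℂ) ≃ᵐ GaugeConfig d L (Matrix.specialUnitaryGroup (Fin 2) ℂ)) × (GaugeConfig d L (Matrix.specialUnitaryGroup (Fin 2) ℂ) → ℝ)),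
      layers.map (fun Ly => ((Ly.1 : GaugeConfig d L (Matrix.specialUnitaryGroup (Fin 2) ℂ) → GaugeConfig d L (Matrix.specialUnitaryGroup (Fin 2) ℂ)), Ly.2)) =
        sched.map (fun s =>
          ((fun (V : GaugeConfig d L (Matrix.specialUnitaryGroup (Fin 2) ℂ)) (e : Edge d L) =>
            if P s e then gaussUnit (geodesicKick (εf s) (Jf s V e)
              (vecQuat ((V e : Matrix.specialUnitaryGroup (Fin 2) ℂ) : Matrix (Fin 2) (Fin 2) ℂ)))
            else V e),
           fun V : GaugeConfig d L (Matrix.specialUnitaryGroup (Fin 2) ℂ) => ∏ a : {e : Edge d L // P s e},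
            (if Real.sin (angle (Jf s V a.1) (vecQuat ((V a.1 : Matrix.specialUnitaryGroup (Fin 2) ℂ) : Matrix (Fin 2) (Fin 2) ℂ))) = 0 then
                (1 - εf s * ‖Jf s V a.1‖ * Real.cos (angle (Jf s V a.1) (vecQuat ((V a.1 : Matrix.specialUnitaryGroup (Fin 2) ℂ) : Matrix (Fin 2) (Fin 2) ℂ)))) ^ 3
              else kickJac (εf s * ‖Jf s V a.1‖) 2 (angle (Jf s V a.1) (vecQuat ((V a.1 : Matrix.specialUnitaryGroup (Fin 2) ℂ) : Matrix (Fin 2) (Fin 2) ℂ)))))) ∧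
      ∃ δ : ℝ, 0 < δ ∧ δ ≤ 1 ∧ ∀ (μ₀ : Measure (GaugeConfig d L (Matrix.specialUnitaryGroup (Fin 2) ℂ))) [IsProbabilityMeasure μ₀] (t : ℕ) (A : Set (GaugeConfig d L (Matrix.specialUnitaryGroup (Fin 2) ℂ))),
        |((fun m : Measure (GaugeConfig d L (Matrix.specialUnitaryGroup (Fin 2) ℂ)) =>
              m.bind (conjKernel (su2LeapfrogHMC ε' κ' hg fun V => S ((layers.foldr (fun Ly (F : GaugeConfig d L (Matrix.specialUnitaryGroup (Fin 2) ℂ) ≃ᵐ GaugeConfig d L (Matrix.specialUnitaryGroup (Fin 2) ℂ)) => Ly.1.trans F) (MeasurableEquiv.refl (GaugeConfig d L (Matrix.specialUnitaryGroup (Fin 2) ℂ)))) V) -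
                Real.log ((layers.foldr (fun Ly K => fun v => Ly.2 v * K (Ly.1 v)) (fun _ => (1 : ℝ))) V)) (layers.foldr (fun Ly (F : GaugeConfig d L (Matrix.specialUnitaryGroup (Fin 2) ℂ) ≃ᵐ GaugeConfig d L (Matrix.specialUnitaryGroup (Fin 2) ℂ)) => Ly.1.trans F) (MeasurableEquiv.refl (GaugeConfig d L (Matrix.specialUnitaryGroup (Fin 2) ℂ))))))^[t] μ₀).real A
            - (su2GibbsLaw S).real A| ≤ (1 - δ) ^ t := by
  have hlt : ∀ s (V : GaugeConfig d L (Matrix.specialUnitaryGroup (Fin 2) ℂ)) (e : Edge d L), P s e → |εf s| * ‖Jf s V e‖ < 1 :=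
    fun s V e he => (hκ s V e he).trans_lt hκ₀
  obtain ⟨layers, hmap, hpos, hmeas, hjac⟩ := exists_layers_su2MaskedKick P εf Jf hJm hJloc hlt sched
  refine ⟨layers, hmap, ?_⟩
  obtain ⟨hfpos, hfmeas, hfjac⟩ := hasJacobian_foldr_trans layers hpos hmeas hjac
  -- every packaged density is one of the schedule's booked densities, hence pinched
  have hpinch : ∀ Ly ∈ layers, ∀ v, Ly.2 v ∈
      Icc ((1 - κ₀) ^ (3 * Fintype.card (Edge d L))) ((1 + κ₀) ^ (3 * Fintype.card (Edge d L))) := by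
    intro Ly hLy v
    have hmem : ((Ly.1 : GaugeConfig d L (Matrix.specialUnitaryGroup (Fin 2) ℂ) → GaugeConfig d L (Matrix.specialUnitaryGroup (Fin 2) ℂ)), Ly.2) ∈
        sched.map (fun s =>
          ((fun (V : GaugeConfig d L (Matrix.specialUnitaryGroup (Fin 2) ℂ)) (e : Edge d L) =>
            if P s e then gaussUnit (geodesicKick (εf s) (Jf s V e)
              (vecQuat ((V e : Matrix.specialUnitaryGroup (Fin 2) ℂ) : Matrix (Fin 2) (Fin 2) ℂ)))
            else V e),
           fun V : GaugeConfig d L (Matrix.specialUnitaryGroup (Fin 2) ℂ) => ∏ a : {e : Edge d L // P s e},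
            (if Real.sin (angle (Jf s V a.1) (vecQuat ((V a.1 : Matrix.specialUnitaryGroup (Fin 2) ℂ) : Matrix (Fin 2) (Fin 2) ℂ))) = 0 then
                (1 - εf s * ‖Jf s V a.1‖ * Real.cos (angle (Jf s V a.1) (vecQuat ((V a.1 : Matrix.specialUnitaryGroup (Fin 2) ℂ) : Matrix (Fin 2) (Fin 2) ℂ)))) ^ 3
              else kickJac (εf s * ‖Jf s V a.1‖) 2 (angle (Jf s V a.1) (vecQuat ((V a.1 : Matrix.specialUnitaryGroup (Fin 2) ℂ) : Matrix (Fin 2) (Fin 2) ℂ)))))) := by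
      rw [← hmap]
      exact List.mem_map.mpr ⟨Ly, hLy, rfl⟩
    obtain ⟨s, -, hs⟩ := List.mem_map.mp hmem
    have hJ2 : Ly.2 = fun V : GaugeConfig d L (Matrix.specialUnitaryGroup (Fin 2) ℂ) => ∏ a : {e : Edge d L // P s e},
            (if Real.sin (angle (Jf s V a.1) (vecQuat ((V a.1 : Matrix.specialUnitaryGroup (Fin 2) ℂ) : Matrix (Fin 2) (Fin 2) ℂ))) = 0 then
                (1 - εf s * ‖Jf s V a.1‖ * Real.cos (angle (Jf s V a.1) (vecQuat ((V a.1 : Matrix.specialUnitaryGroup (Fin 2) ℂ) : Matrix (Fin 2) (Fin 2) ℂ)))) ^ 3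
              else kickJac (εf s * ‖Jf s V a.1‖) 2 (angle (Jf s V a.1) (vecQuat ((V a.1 : Matrix.specialUnitaryGroup (Fin 2) ℂ) : Matrix (Fin 2) (Fin 2) ℂ)))) := (Prod.mk.inj hs).2.symm
    have h := su2MaskedKickJacobian_mem_Icc (P s) (Jf s) (ε := εf s) hκ₀.le (hκ s) v
    rw [hJ2]
    have hn : Fintype.card {e : Edge d L // P s e} ≤ Fintype.card (Edge d L) := Fintype.card_subtype_le _
    refine ⟨le_trans ?_ h.1, h.2.trans ?_⟩
    · exact pow_le_pow_of_le_one (by linarith) (by linarith) (by omega)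
    · exact pow_le_pow_right₀ (by linarith) (by omega)
  have hfold := fun v => foldr_logDet_mem_Icc layers (pow_nonneg (by linarith) _) hpinch v
  exact su2LeapfrogFTHMC_uniformlyErgodic hε' hκ' hg hb0 hb hS hs
    (pow_pos (pow_pos (by linarith) _) _) (fun v => (hfold v).1) (fun v => (hfold v).2) hfmeas hfjac

/-- **… and `π_S` is the unique invariant probability law of the member's reported kernel.** -/
theorem su2MaskedKickSchedule_fthmc_invariant_unique (εf : σ → ℝ)
    (Jf : σ → GaugeConfig d L (Matrix.specialUnitaryGroup (Fin 2) ℂ) → Edge d L → R4)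
    (hJm : ∀ s e, P s e → Measurable fun V : GaugeConfig d L (Matrix.specialUnitaryGroup (Fin 2) ℂ) => Jf s V e)
    (hJloc : ∀ s (V W : GaugeConfig d L (Matrix.specialUnitaryGroup (Fin 2) ℂ)),
      (∀ j, ¬P s j → V j = W j) → ∀ e, P s e → Jf s V e = Jf s W e)
    {κ₀ : ℝ} (hκ0 : 0 ≤ κ₀) (hκ₀ : κ₀ < 1)
    (hκ : ∀ s (V : GaugeConfig d L (Matrix.specialUnitaryGroup (Fin 2) ℂ)) (e : Edge d L), P s e → |εf s| * ‖Jf s V e‖ ≤ κ₀)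
    (sched : List σ)
    {ε' κ' : ℝ} (hε' : 0 < ε') (hκ' : 0 < κ')
    {g : GaugeConfig d L (Matrix.specialUnitaryGroup (Fin 2) ℂ) → Edge d L → EuclideanSpace ℝ (Fin 3)} (hg : Measurable g) {b' : ℝ} (hb0 : 0 ≤ b')
    (hb : ∀ u l, ‖g u l‖ ≤ b') {S : GaugeConfig d L (Matrix.specialUnitaryGroup (Fin 2) ℂ) → ℝ} (hS : Measurable S) {s' : ℝ} (hs : ∀ u, |S u| ≤ s') :
    ∃ layers : List ((GaugeConfig d L (Matrix.specialUnitaryGroup (Fin 2) ℂ) ≃ᵐ GaugeConfig d L (Matrix.specialUnitaryGroup (Fin 2) ℂ)) × (GaugeConfig d L (Matrix.specialUnitaryGroup (Fin 2) ℂ) → ℝ)),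
      layers.map (fun Ly => ((Ly.1 : GaugeConfig d L (Matrix.specialUnitaryGroup (Fin 2) ℂ) → GaugeConfig d L (Matrix.specialUnitaryGroup (Fin 2) ℂ)), Ly.2)) =
        sched.map (fun s =>
          ((fun (V : GaugeConfig d L (Matrix.specialUnitaryGroup (Fin 2) ℂ)) (e : Edge d L) =>
            if P s e then gaussUnit (geodesicKick (εf s) (Jf s V e)
              (vecQuat ((V e : Matrix.specialUnitaryGroup (Fin 2) ℂ) : Matrix (Fin 2) (Fin 2) ℂ)))
            else V e),
           fun V : GaugeConfig d L (Matrix.specialUnitaryGroup (Fin 2) ℂ) => ∏ a : {e : Edge d L // P s e},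
            (if Real.sin (angle (Jf s V a.1) (vecQuat ((V a.1 : Matrix.specialUnitaryGroup (Fin 2) ℂ) : Matrix (Fin 2) (Fin 2) ℂ))) = 0 then
                (1 - εf s * ‖Jf s V a.1‖ * Real.cos (angle (Jf s V a.1) (vecQuat ((V a.1 : Matrix.specialUnitaryGroup (Fin 2) ℂ) : Matrix (Fin 2) (Fin 2) ℂ)))) ^ 3
              else kickJac (εf s * ‖Jf s V a.1‖) 2 (angle (Jf s V a.1) (vecQuat ((V a.1 : Matrix.specialUnitaryGroup (Fin 2) ℂ) : Matrix (Fin 2) (Fin 2) ℂ)))))) ∧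
      ∀ (π' : Measure (GaugeConfig d L (Matrix.specialUnitaryGroup (Fin 2) ℂ))) [IsProbabilityMeasure π'],
        Invariant (conjKernel (su2LeapfrogHMC ε' κ' hg fun V => S ((layers.foldr (fun Ly (F : GaugeConfig d L (Matrix.specialUnitaryGroup (Fin 2) ℂ) ≃ᵐ GaugeConfig d L (Matrix.specialUnitaryGroup (Fin 2) ℂ)) => Ly.1.trans F) (MeasurableEquiv.refl (GaugeConfig d L (Matrix.specialUnitaryGroup (Fin 2) ℂ)))) V) -
            Real.log ((layers.foldr (fun Ly K => fun v => Ly.2 v * K (Ly.1 v)) (fun _ => (1 : ℝ))) V)) (layers.foldr (fun Ly (F : GaugeConfig d L (Matrix.specialUnitaryGroup (Fin 2) ℂ) ≃ᵐ GaugeConfig d L (Matrix.specialUnitaryGroup (Fin 2) ℂ)) => Ly.1.trans F) (MeasurableEquiv.refl (GaugeConfig d L (Matrix.specialUnitaryGroup (Fin 2) ℂ))))) π' →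
        π' = su2GibbsLaw S := by
  have hlt : ∀ s (V : GaugeConfig d L (Matrix.specialUnitaryGroup (Fin 2) ℂ)) (e : Edge d L), P s e → |εf s| * ‖Jf s V e‖ < 1 :=
    fun s V e he => (hκ s V e he).trans_lt hκ₀
  obtain ⟨layers, hmap, hpos, hmeas, hjac⟩ := exists_layers_su2MaskedKick P εf Jf hJm hJloc hlt sched
  refine ⟨layers, hmap, fun π' _ hπ' => ?_⟩
  obtain ⟨hfpos, hfmeas, hfjac⟩ := hasJacobian_foldr_trans layers hpos hmeas hjac
  have hpinch : ∀ Ly ∈ layers, ∀ v, Ly.2 v ∈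
      Icc ((1 - κ₀) ^ (3 * Fintype.card (Edge d L))) ((1 + κ₀) ^ (3 * Fintype.card (Edge d L))) := by
    intro Ly hLy v
    have hmem : ((Ly.1 : GaugeConfig d L (Matrix.specialUnitaryGroup (Fin 2) ℂ) → GaugeConfig d L (Matrix.specialUnitaryGroup (Fin 2) ℂ)), Ly.2) ∈
        sched.map (fun s =>
          ((fun (V : GaugeConfig d L (Matrix.specialUnitaryGroup (Fin 2) ℂ)) (e : Edge d L) =>
            if P s e then gaussUnit (geodesicKick (εf s) (Jf s V e)
              (vecQuat ((V e : Matrix.specialUnitaryGroup (Fin 2) ℂ) : Matrix (Fin 2) (Fin 2) ℂ)))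
            else V e),
           fun V : GaugeConfig d L (Matrix.specialUnitaryGroup (Fin 2) ℂ) => ∏ a : {e : Edge d L // P s e},
            (if Real.sin (angle (Jf s V a.1) (vecQuat ((V a.1 : Matrix.specialUnitaryGroup (Fin 2) ℂ) : Matrix (Fin 2) (Fin 2) ℂ))) = 0 then
                (1 - εf s * ‖Jf s V a.1‖ * Real.cos (angle (Jf s V a.1) (vecQuat ((V a.1 : Matrix.specialUnitaryGroup (Fin 2) ℂ) : Matrix (Fin 2) (Fin 2) ℂ)))) ^ 3
              else kickJac (εf s * ‖Jf s V a.1‖) 2 (angle (Jf s V a.1) (vecQuat ((V a.1 : Matrix.specialUnitaryGroup (Fin 2) ℂ) : Matrix (Fin 2) (Fin 2) ℂ)))))) := by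
      rw [← hmap]
      exact List.mem_map.mpr ⟨Ly, hLy, rfl⟩
    obtain ⟨s, -, hs⟩ := List.mem_map.mp hmem
    have hJ2 : Ly.2 = fun V : GaugeConfig d L (Matrix.specialUnitaryGroup (Fin 2) ℂ) => ∏ a : {e : Edge d L // P s e},
            (if Real.sin (angle (Jf s V a.1) (vecQuat ((V a.1 : Matrix.specialUnitaryGroup (Fin 2) ℂ) : Matrix (Fin 2) (Fin 2) ℂ))) = 0 then
                (1 - εf s * ‖Jf s V a.1‖ * Real.cos (angle (Jf s V a.1) (vecQuat ((V a.1 : Matrix.specialUnitaryGroup (Fin 2) ℂ) : Matrix (Fin 2) (Fin 2) ℂ)))) ^ 3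
              else kickJac (εf s * ‖Jf s V a.1‖) 2 (angle (Jf s V a.1) (vecQuat ((V a.1 : Matrix.specialUnitaryGroup (Fin 2) ℂ) : Matrix (Fin 2) (Fin 2) ℂ)))) := (Prod.mk.inj hs).2.symm
    have h := su2MaskedKickJacobian_mem_Icc (P s) (Jf s) (ε := εf s) hκ₀.le (hκ s) v
    rw [hJ2]
    have hn : Fintype.card {e : Edge d L // P s e} ≤ Fintype.card (Edge d L) := Fintype.card_subtype_le _
    refine ⟨le_trans ?_ h.1, h.2.trans ?_⟩
    · exact pow_le_pow_of_le_one (by linarith) (by linarith) (by omega)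
    · exact pow_le_pow_right₀ (by linarith) (by omega)
  have hfold := fun v => foldr_logDet_mem_Icc layers (pow_nonneg (by linarith) _) hpinch v
  exact su2LeapfrogFTHMC_invariant_unique hε' hκ' hg hb0 hb hS hs
    (pow_pos (pow_pos (by linarith) _) _) (fun v => (hfold v).1) (fun v => (hfold v).2) hfmeas hfjac hπ'

end Schedule

/-! ## The engine's LO member (any schedule) -/

section LO

variable {d L : ℕ} {X : Type*} [DecidableEq X] (χ : Site d L → X) [NeZero L]

/-- **FT-HMC (row 9's single-step leapfrog kernel) through the engine's WHOLE LO Wilson-flow member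
— ANY schedule `sched : List (Fin d × X)` of masked sub-steps, e.g. the Lüscher sweep of
`SU2WilsonFlowLOAcceptanceLattice` — is uniformly ergodic.**  Proper colouring, `2(d−1)|ε| < 1`;
the list of layers is packaged VERBATIM as in `exists_layers_su2WilsonFlowLO`. -/
theorem su2WilsonFlowLO_member_fthmc_uniformlyErgodic
    (hχ : ∀ (x : Site d L) (i : Fin d), χ (x.shift i) ≠ χ x) {ε : ℝ}
    (hε : |ε| * (2 * ((d - 1 : ℕ) : ℝ)) < 1) (sched : List (Fin d × X))
    {ε' κ' : ℝ} (hε' : 0 < ε') (hκ' : 0 < κ')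
    {g : GaugeConfig d L (Matrix.specialUnitaryGroup (Fin 2) ℂ) → Edge d L → EuclideanSpace ℝ (Fin 3)} (hg : Measurable g) {b' : ℝ} (hb0 : 0 ≤ b')
    (hb : ∀ u l, ‖g u l‖ ≤ b') {S : GaugeConfig d L (Matrix.specialUnitaryGroup (Fin 2) ℂ) → ℝ} (hS : Measurable S) {s' : ℝ} (hs : ∀ u, |S u| ≤ s') :
    ∃ layers : List ((GaugeConfig d L (Matrix.specialUnitaryGroup (Fin 2) ℂ) ≃ᵐ GaugeConfig d L (Matrix.specialUnitaryGroup (Fin 2) ℂ)) × (GaugeConfig d L (Matrix.specialUnitaryGroup (Fin 2) ℂ) → ℝ)),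
      layers.map (fun Ly => ((Ly.1 : GaugeConfig d L (Matrix.specialUnitaryGroup (Fin 2) ℂ) → GaugeConfig d L (Matrix.specialUnitaryGroup (Fin 2) ℂ)), Ly.2)) =
        sched.map (fun s =>
        ((fun (V : GaugeConfig d L (Matrix.specialUnitaryGroup (Fin 2) ℂ)) (e : Edge d L) =>
        if e.2 = s.1 ∧ χ e.1 = s.2 then
          gaussUnit (geodesicKick ε (∑ ν ∈ Finset.univ.erase e.2,
            (vecQuat (((V (Site.shift e.1 e.2, ν) * (V (Site.shift e.1 ν, e.2))⁻¹ * (V (e.1, ν))⁻¹)⁻¹ : (Matrix.specialUnitaryGroup (Fin 2) ℂ)) : Matrix (Fin 2) (Fin 2) ℂ) +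
              vecQuat ((((V (Site.shift (e.1 - Pi.single ν 1) e.2, ν))⁻¹ * (V (e.1 - Pi.single ν 1, e.2))⁻¹ *
                V (e.1 - Pi.single ν 1, ν))⁻¹ : (Matrix.specialUnitaryGroup (Fin 2) ℂ)) : Matrix (Fin 2) (Fin 2) ℂ)))
            (vecQuat ((V e : (Matrix.specialUnitaryGroup (Fin 2) ℂ)) : Matrix (Fin 2) (Fin 2) ℂ)))
        else V e),
         fun V : GaugeConfig d L (Matrix.specialUnitaryGroup (Fin 2) ℂ) => ∏ a : {e : Edge d L // e.2 = s.1 ∧ χ e.1 = s.2},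
          (if Real.sin (angle (∑ ν ∈ Finset.univ.erase a.1.2,
            (vecQuat (((V (Site.shift a.1.1 a.1.2, ν) * (V (Site.shift a.1.1 ν, a.1.2))⁻¹ * (V (a.1.1, ν))⁻¹)⁻¹ : (Matrix.specialUnitaryGroup (Fin 2) ℂ)) : Matrix (Fin 2) (Fin 2) ℂ) +
              vecQuat ((((V (Site.shift (a.1.1 - Pi.single ν 1) a.1.2, ν))⁻¹ * (V (a.1.1 - Pi.single ν 1, a.1.2))⁻¹ *
                V (a.1.1 - Pi.single ν 1, ν))⁻¹ : (Matrix.specialUnitaryGroup (Fin 2) ℂ)) : Matrix (Fin 2) (Fin 2) ℂ))) (vecQuat ((V a.1 : (Matrix.specialUnitaryGroup (Fin 2) ℂ)) : Matrix (Fin 2) (Fin 2) ℂ))) = 0 then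
            (1 - ε * ‖(∑ ν ∈ Finset.univ.erase a.1.2,
            (vecQuat (((V (Site.shift a.1.1 a.1.2, ν) * (V (Site.shift a.1.1 ν, a.1.2))⁻¹ * (V (a.1.1, ν))⁻¹)⁻¹ : (Matrix.specialUnitaryGroup (Fin 2) ℂ)) : Matrix (Fin 2) (Fin 2) ℂ) +
              vecQuat ((((V (Site.shift (a.1.1 - Pi.single ν 1) a.1.2, ν))⁻¹ * (V (a.1.1 - Pi.single ν 1, a.1.2))⁻¹ *
                V (a.1.1 - Pi.single ν 1, ν))⁻¹ : (Matrix.specialUnitaryGroup (Fin 2) ℂ)) : Matrix (Fin 2) (Fin 2) ℂ)))‖ * Real.cos (angle (∑ ν ∈ Finset.univ.erase a.1.2,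
            (vecQuat (((V (Site.shift a.1.1 a.1.2, ν) * (V (Site.shift a.1.1 ν, a.1.2))⁻¹ * (V (a.1.1, ν))⁻¹)⁻¹ : (Matrix.specialUnitaryGroup (Fin 2) ℂ)) : Matrix (Fin 2) (Fin 2) ℂ) +
              vecQuat ((((V (Site.shift (a.1.1 - Pi.single ν 1) a.1.2, ν))⁻¹ * (V (a.1.1 - Pi.single ν 1, a.1.2))⁻¹ *
                V (a.1.1 - Pi.single ν 1, ν))⁻¹ : (Matrix.specialUnitaryGroup (Fin 2) ℂ)) : Matrix (Fin 2) (Fin 2) ℂ))) (vecQuat ((V a.1 : (Matrix.specialUnitaryGroup (Fin 2) ℂ)) : Matrix (Fin 2) (Fin 2) ℂ)))) ^ 3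
          else kickJac (ε * ‖(∑ ν ∈ Finset.univ.erase a.1.2,
            (vecQuat (((V (Site.shift a.1.1 a.1.2, ν) * (V (Site.shift a.1.1 ν, a.1.2))⁻¹ * (V (a.1.1, ν))⁻¹)⁻¹ : (Matrix.specialUnitaryGroup (Fin 2) ℂ)) : Matrix (Fin 2) (Fin 2) ℂ) +
              vecQuat ((((V (Site.shift (a.1.1 - Pi.single ν 1) a.1.2, ν))⁻¹ * (V (a.1.1 - Pi.single ν 1, a.1.2))⁻¹ *
                V (a.1.1 - Pi.single ν 1, ν))⁻¹ : (Matrix.specialUnitaryGroup (Fin 2) ℂ)) : Matrix (Fin 2) (Fin 2) ℂ)))‖) 2 (angle (∑ ν ∈ Finset.univ.erase a.1.2,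
            (vecQuat (((V (Site.shift a.1.1 a.1.2, ν) * (V (Site.shift a.1.1 ν, a.1.2))⁻¹ * (V (a.1.1, ν))⁻¹)⁻¹ : (Matrix.specialUnitaryGroup (Fin 2) ℂ)) : Matrix (Fin 2) (Fin 2) ℂ) +
              vecQuat ((((V (Site.shift (a.1.1 - Pi.single ν 1) a.1.2, ν))⁻¹ * (V (a.1.1 - Pi.single ν 1, a.1.2))⁻¹ *
                V (a.1.1 - Pi.single ν 1, ν))⁻¹ : (Matrix.specialUnitaryGroup (Fin 2) ℂ)) : Matrix (Fin 2) (Fin 2) ℂ))) (vecQuat ((V a.1 : (Matrix.specialUnitaryGroup (Fin 2) ℂ)) : Matrix (Fin 2) (Fin 2) ℂ)))))) ∧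
      ∃ δ : ℝ, 0 < δ ∧ δ ≤ 1 ∧ ∀ (μ₀ : Measure (GaugeConfig d L (Matrix.specialUnitaryGroup (Fin 2) ℂ))) [IsProbabilityMeasure μ₀] (t : ℕ) (A : Set (GaugeConfig d L (Matrix.specialUnitaryGroup (Fin 2) ℂ))),
        |((fun m : Measure (GaugeConfig d L (Matrix.specialUnitaryGroup (Fin 2) ℂ)) =>
              m.bind (conjKernel (su2LeapfrogHMC ε' κ' hg fun V => S ((layers.foldr (fun Ly (F : GaugeConfig d L (Matrix.specialUnitaryGroup (Fin 2) ℂ) ≃ᵐ GaugeConfig d L (Matrix.specialUnitaryGroup (Fin 2) ℂ)) => Ly.1.trans F) (MeasurableEquiv.refl (GaugeConfig d L (Matrix.specialUnitaryGroup (Fin 2) ℂ)))) V) -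
                Real.log ((layers.foldr (fun Ly K => fun v => Ly.2 v * K (Ly.1 v)) (fun _ => (1 : ℝ))) V)) (layers.foldr (fun Ly (F : GaugeConfig d L (Matrix.specialUnitaryGroup (Fin 2) ℂ) ≃ᵐ GaugeConfig d L (Matrix.specialUnitaryGroup (Fin 2) ℂ)) => Ly.1.trans F) (MeasurableEquiv.refl (GaugeConfig d L (Matrix.specialUnitaryGroup (Fin 2) ℂ))))))^[t] μ₀).real A
            - (su2GibbsLaw S).real A| ≤ (1 - δ) ^ t := by
  have h := su2MaskedKickSchedule_fthmc_uniformlyErgodic (fun (s : Fin d × X) (e : Edge d L) => e.2 = s.1 ∧ χ e.1 = s.2)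
    (fun _ => ε) (fun _ => fun (V : GaugeConfig d L (Matrix.specialUnitaryGroup (Fin 2) ℂ)) (e : Edge d L) => ∑ ν ∈ Finset.univ.erase e.2,
        (vecQuat (((V (Site.shift e.1 e.2, ν) * (V (Site.shift e.1 ν, e.2))⁻¹ * (V (e.1, ν))⁻¹)⁻¹ : Matrix.specialUnitaryGroup (Fin 2) ℂ) : Matrix (Fin 2) (Fin 2) ℂ) +
          vecQuat ((((V (Site.shift (e.1 - Pi.single ν 1) e.2, ν))⁻¹ * (V (e.1 - Pi.single ν 1, e.2))⁻¹ * V (e.1 - Pi.single ν 1, ν))⁻¹ : Matrix.specialUnitaryGroup (Fin 2) ℂ) : Matrix (Fin 2) (Fin 2) ℂ)))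
    (fun _ e _ => (continuous_stapleJ e).measurable)
    (fun _ V W hVW e he => stapleJ_local χ hχ he hVW)
    (mul_nonneg (abs_nonneg ε) (by positivity)) hε
    (fun _ V e _ => mul_le_mul_of_nonneg_left (norm_stapleJ_le V e) (abs_nonneg ε))
    sched hε' hκ' hg hb0 hb hS hs
  beta_reduce at h
  exact h

end LO

/-! ## The engine's learned member (any schedule) -/

section Residual

variable {d L : ℕ} {X : Type*} [DecidableEq X] (χ : Site d L → X) [NeZero L] {σ : Type*}

/-- **FT-HMC (row 9's single-step leapfrog kernel) through a whole LEARNED residual member — any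
schedule of layer specs `s : σ` (direction `μf s`, class `bf s`, constant `cf s`, weights `ρf s`
measurable and frozen) under the UNIFORM refusal bound `|cf s| Σ_ν(|ρ₀| + |ρ₁|) ≤ κ₀`,
`0 ≤ κ₀ < 1` (the engine's `tanh` squashing) — is uniformly ergodic.**  Layers packaged VERBATIM
as in `exists_layers_su2Residual`. -/
theorem su2Residual_member_fthmc_uniformlyErgodic
    (hχ : ∀ (x : Site d L) (i : Fin d), χ (x.shift i) ≠ χ x) (μf : σ → Fin d) (bf : σ → X) (cf : σ → ℝ)
    (ρf : σ → GaugeConfig d L (Matrix.specialUnitaryGroup (Fin 2) ℂ) → Edge d L → Fin d → Fin 2 → ℝ)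
    (hρm : ∀ s e ν t, Measurable fun V : GaugeConfig d L (Matrix.specialUnitaryGroup (Fin 2) ℂ) => ρf s V e ν t)
    (hρloc : ∀ s (V W : GaugeConfig d L (Matrix.specialUnitaryGroup (Fin 2) ℂ)),
      (∀ j : Edge d L, ¬(j.2 = μf s ∧ χ j.1 = bf s) → V j = W j) →
        ∀ e : Edge d L, (e.2 = μf s ∧ χ e.1 = bf s) → ∀ ν t, ρf s V e ν t = ρf s W e ν t)
    {κ₀ : ℝ} (hκ0 : 0 ≤ κ₀) (hκ₀ : κ₀ < 1)
    (hκ : ∀ s (V : GaugeConfig d L (Matrix.specialUnitaryGroup (Fin 2) ℂ)) (e : Edge d L), (e.2 = μf s ∧ χ e.1 = bf s) →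
      |cf s| * ∑ ν ∈ Finset.univ.erase e.2, (|ρf s V e ν 0| + |ρf s V e ν 1|) ≤ κ₀)
    (sched : List σ)
    {ε' κ' : ℝ} (hε' : 0 < ε') (hκ' : 0 < κ')
    {g : GaugeConfig d L (Matrix.specialUnitaryGroup (Fin 2) ℂ) → Edge d L → EuclideanSpace ℝ (Fin 3)} (hg : Measurable g) {b' : ℝ} (hb0 : 0 ≤ b')
    (hb : ∀ u l, ‖g u l‖ ≤ b') {S : GaugeConfig d L (Matrix.specialUnitaryGroup (Fin 2) ℂ) → ℝ} (hS : Measurable S) {s' : ℝ} (hs : ∀ u, |S u| ≤ s') :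
    ∃ layers : List ((GaugeConfig d L (Matrix.specialUnitaryGroup (Fin 2) ℂ) ≃ᵐ GaugeConfig d L (Matrix.specialUnitaryGroup (Fin 2) ℂ)) × (GaugeConfig d L (Matrix.specialUnitaryGroup (Fin 2) ℂ) → ℝ)),
      layers.map (fun Ly => ((Ly.1 : GaugeConfig d L (Matrix.specialUnitaryGroup (Fin 2) ℂ) → GaugeConfig d L (Matrix.specialUnitaryGroup (Fin 2) ℂ)), Ly.2)) =
        sched.map (fun s =>
          ((fun (V : GaugeConfig d L (Matrix.specialUnitaryGroup (Fin 2) ℂ)) (e : Edge d L) =>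
        if e.2 = μf s ∧ χ e.1 = bf s then
          gaussUnit (geodesicKick (cf s) (∑ ν ∈ Finset.univ.erase e.2,
            (ρf s V e ν 0 • vecQuat (((V (Site.shift e.1 e.2, ν) * (V (Site.shift e.1 ν, e.2))⁻¹ * (V (e.1, ν))⁻¹)⁻¹ : Matrix.specialUnitaryGroup (Fin 2) ℂ) : Matrix (Fin 2) (Fin 2) ℂ) +
              ρf s V e ν 1 • vecQuat ((((V (Site.shift (e.1 - Pi.single ν 1) e.2, ν))⁻¹ * (V (e.1 - Pi.single ν 1, e.2))⁻¹ * V (e.1 - Pi.single ν 1, ν))⁻¹ : Matrix.specialUnitaryGroup (Fin 2) ℂ) : Matrix (Fin 2) (Fin 2) ℂ)))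
            (vecQuat ((V e : Matrix.specialUnitaryGroup (Fin 2) ℂ) : Matrix (Fin 2) (Fin 2) ℂ)))
        else V e),
           fun V : GaugeConfig d L (Matrix.specialUnitaryGroup (Fin 2) ℂ) => ∏ a : {e : Edge d L // e.2 = μf s ∧ χ e.1 = bf s},
          (if Real.sin (angle (∑ ν ∈ Finset.univ.erase a.1.2,
            (ρf s V a.1 ν 0 • vecQuat (((V (Site.shift a.1.1 a.1.2, ν) * (V (Site.shift a.1.1 ν, a.1.2))⁻¹ * (V (a.1.1, ν))⁻¹)⁻¹ : Matrix.specialUnitaryGroup (Fin 2) ℂ) : Matrix (Fin 2) (Fin 2) ℂ) +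
              ρf s V a.1 ν 1 • vecQuat ((((V (Site.shift (a.1.1 - Pi.single ν 1) a.1.2, ν))⁻¹ * (V (a.1.1 - Pi.single ν 1, a.1.2))⁻¹ * V (a.1.1 - Pi.single ν 1, ν))⁻¹ : Matrix.specialUnitaryGroup (Fin 2) ℂ) : Matrix (Fin 2) (Fin 2) ℂ))) (vecQuat ((V a.1 : Matrix.specialUnitaryGroup (Fin 2) ℂ) : Matrix (Fin 2) (Fin 2) ℂ))) = 0 then
            (1 - cf s * ‖(∑ ν ∈ Finset.univ.erase a.1.2,
            (ρf s V a.1 ν 0 • vecQuat (((V (Site.shift a.1.1 a.1.2, ν) * (V (Site.shift a.1.1 ν, a.1.2))⁻¹ * (V (a.1.1, ν))⁻¹)⁻¹ : Matrix.specialUnitaryGroup (Fin 2) ℂ) : Matrix (Fin 2) (Fin 2) ℂ) +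
              ρf s V a.1 ν 1 • vecQuat ((((V (Site.shift (a.1.1 - Pi.single ν 1) a.1.2, ν))⁻¹ * (V (a.1.1 - Pi.single ν 1, a.1.2))⁻¹ * V (a.1.1 - Pi.single ν 1, ν))⁻¹ : Matrix.specialUnitaryGroup (Fin 2) ℂ) : Matrix (Fin 2) (Fin 2) ℂ)))‖ * Real.cos (angle (∑ ν ∈ Finset.univ.erase a.1.2,
            (ρf s V a.1 ν 0 • vecQuat (((V (Site.shift a.1.1 a.1.2, ν) * (V (Site.shift a.1.1 ν, a.1.2))⁻¹ * (V (a.1.1, ν))⁻¹)⁻¹ : Matrix.specialUnitaryGroup (Fin 2) ℂ) : Matrix (Fin 2) (Fin 2) ℂ) +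
              ρf s V a.1 ν 1 • vecQuat ((((V (Site.shift (a.1.1 - Pi.single ν 1) a.1.2, ν))⁻¹ * (V (a.1.1 - Pi.single ν 1, a.1.2))⁻¹ * V (a.1.1 - Pi.single ν 1, ν))⁻¹ : Matrix.specialUnitaryGroup (Fin 2) ℂ) : Matrix (Fin 2) (Fin 2) ℂ))) (vecQuat ((V a.1 : Matrix.specialUnitaryGroup (Fin 2) ℂ) : Matrix (Fin 2) (Fin 2) ℂ)))) ^ 3
          else kickJac (cf s * ‖(∑ ν ∈ Finset.univ.erase a.1.2,
            (ρf s V a.1 ν 0 • vecQuat (((V (Site.shift a.1.1 a.1.2, ν) * (V (Site.shift a.1.1 ν, a.1.2))⁻¹ * (V (a.1.1, ν))⁻¹)⁻¹ : Matrix.specialUnitaryGroup (Fin 2) ℂ) : Matrix (Fin 2) (Fin 2) ℂ) +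
              ρf s V a.1 ν 1 • vecQuat ((((V (Site.shift (a.1.1 - Pi.single ν 1) a.1.2, ν))⁻¹ * (V (a.1.1 - Pi.single ν 1, a.1.2))⁻¹ * V (a.1.1 - Pi.single ν 1, ν))⁻¹ : Matrix.specialUnitaryGroup (Fin 2) ℂ) : Matrix (Fin 2) (Fin 2) ℂ)))‖) 2 (angle (∑ ν ∈ Finset.univ.erase a.1.2,
            (ρf s V a.1 ν 0 • vecQuat (((V (Site.shift a.1.1 a.1.2, ν) * (V (Site.shift a.1.1 ν, a.1.2))⁻¹ * (V (a.1.1, ν))⁻¹)⁻¹ : Matrix.specialUnitaryGroup (Fin 2) ℂ) : Matrix (Fin 2) (Fin 2) ℂ) +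
              ρf s V a.1 ν 1 • vecQuat ((((V (Site.shift (a.1.1 - Pi.single ν 1) a.1.2, ν))⁻¹ * (V (a.1.1 - Pi.single ν 1, a.1.2))⁻¹ * V (a.1.1 - Pi.single ν 1, ν))⁻¹ : Matrix.specialUnitaryGroup (Fin 2) ℂ) : Matrix (Fin 2) (Fin 2) ℂ))) (vecQuat ((V a.1 : Matrix.specialUnitaryGroup (Fin 2) ℂ) : Matrix (Fin 2) (Fin 2) ℂ)))))) ∧
      ∃ δ : ℝ, 0 < δ ∧ δ ≤ 1 ∧ ∀ (μ₀ : Measure (GaugeConfig d L (Matrix.specialUnitaryGroup (Fin 2) ℂ))) [IsProbabilityMeasure μ₀] (t : ℕ) (A : Set (GaugeConfig d L (Matrix.specialUnitaryGroup (Fin 2) ℂ))),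
        |((fun m : Measure (GaugeConfig d L (Matrix.specialUnitaryGroup (Fin 2) ℂ)) =>
              m.bind (conjKernel (su2LeapfrogHMC ε' κ' hg fun V => S ((layers.foldr (fun Ly (F : GaugeConfig d L (Matrix.specialUnitaryGroup (Fin 2) ℂ) ≃ᵐ GaugeConfig d L (Matrix.specialUnitaryGroup (Fin 2) ℂ)) => Ly.1.trans F) (MeasurableEquiv.refl (GaugeConfig d L (Matrix.specialUnitaryGroup (Fin 2) ℂ)))) V) -
                Real.log ((layers.foldr (fun Ly K => fun v => Ly.2 v * K (Ly.1 v)) (fun _ => (1 : ℝ))) V)) (layers.foldr (fun Ly (F : GaugeConfig d L (Matrix.specialUnitaryGroup (Fin 2) ℂ) ≃ᵐ GaugeConfig d L (Matrix.specialUnitaryGroup (Fin 2) ℂ)) => Ly.1.trans F) (MeasurableEquiv.refl (GaugeConfig d L (Matrix.specialUnitaryGroup (Fin 2) ℂ))))))^[t] μ₀).real A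
            - (su2GibbsLaw S).real A| ≤ (1 - δ) ^ t := by
  have h := su2MaskedKickSchedule_fthmc_uniformlyErgodic (fun (s : σ) (e : Edge d L) => e.2 = μf s ∧ χ e.1 = bf s)
    cf (fun s => (fun (V : GaugeConfig d L (Matrix.specialUnitaryGroup (Fin 2) ℂ)) (e : Edge d L) => ∑ ν ∈ Finset.univ.erase e.2,
        (ρf s V e ν 0 • vecQuat (((V (Site.shift e.1 e.2, ν) * (V (Site.shift e.1 ν, e.2))⁻¹ * (V (e.1, ν))⁻¹)⁻¹ : Matrix.specialUnitaryGroup (Fin 2) ℂ) : Matrix (Fin 2) (Fin 2) ℂ) +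
          ρf s V e ν 1 • vecQuat ((((V (Site.shift (e.1 - Pi.single ν 1) e.2, ν))⁻¹ * (V (e.1 - Pi.single ν 1, e.2))⁻¹ * V (e.1 - Pi.single ν 1, ν))⁻¹ : Matrix.specialUnitaryGroup (Fin 2) ℂ) : Matrix (Fin 2) (Fin 2) ℂ))))
    (fun s e _ => measurable_residualJ (ρf s) e (hρm s e))
    (fun s V W hVW e he => residualJ_local χ hχ (ρf s) he hVW (hρloc s V W hVW e he))
    hκ0 hκ₀
    (fun s V e he => (mul_le_mul_of_nonneg_left (norm_residualJ_le (ρf s) V e) (abs_nonneg (cf s))).trans (hκ s V e he))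
    sched hε' hκ' hg hb0 hb hS hs
  beta_reduce at h
  exact h

end Residual

end Summit.Ventures.LatticeQCDFlow.Exactness
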